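import Literature.MathematicalPhysics.QuantumFieldTheory.Balaban1983to89.T3PrintedRegularMinimiser
import Literature.MathematicalPhysics.QuantumFieldTheory.Balaban1983to89.T3DescentFibreTower
import HarnessLib

/-!
# `UnitScaleTiltFluctuationComparisonRegPrPrintChiDescent` — STUB 4′ of crux `FluctuationComparisonRegPrL` (stmt-QuantumFields-19935): THE ONE-STEP
# DESCENT SANDWICH IN THE TREE'S CURRENCY — the 4′ comparison at the comparison height `n` for EVERY window datum (edge band included) from a two-run
# density sandwich ONE LEVEL BELOW on a good set `G` plus the conditional mass of `Gᶜ` in the fibres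

Cell `ym3-torus`, width-lever lane `ym-ust-19935-r1` (strategy (R1) «print's χ of [Balaban1985UV3] (47) back», structural, no numerics); the abstract sandwich is
crux-idea card C6 `descent-below-the-edge-band` of ideator ym-cruxidea-19201-2 (its `Sketch_ideator2_g8.lean` proves the test-function form `descentSandwich`;
re-proved here in set-integral form and INSTANTIATED on the tree's objects).  Count-neutral helper (`--supports stmt-QuantumFields-19935`).  Pure measure
theory and bookkeeping; no estimate of [Balaban1985UV3]/[King1986] is asserted.

THE POINT.  4′ compares, at height `n = ⌊K/m⌋`, the restricted height densities `Ta = ρ^{(K)}` and `Tb = ρ^{(K+1)}` of runs `K`, `K+1` a.e. on the whole sharp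
window — including its edge band, where no per-run representation holds at `L ∈ {3,5}` (FINDING #44).  But `Ta`, `Tb` are the push-forwards, under ONE AND
THE SAME one-step averaging `f = D_{n,n+1}` (tree `descendTo F ℰp n (n+1)`), of the two runs' densities `ρa`, `ρb` one level below (tree: `descendTo_descendTo` +
`map_descendTo_restrict_eq_withDensity`).  Hence (§1, abstract; §2, on the tree's objects): if `e^{κ−r}ρa ≤ ρb ≤ e^{κ+r}ρa` a.e. ON A GOOD SET `G` of level-`(n+1)`
fields and the part of each fibre outside `G` carries relative mass `≤ δ < 1` under both runs, then `|log Tb − log Ta − κ| ≤ r − log(1−δ)` a.e. where both are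
positive — at EVERY datum, with no representation at height `n` at all.  With `G :=` the doubly-χ-good fields of the sibling file `…PrintChi` (print's `χ`
one level down, where the representation IS consistent at every block size), this types the (R1) edge clause as: comparison on χ-good data one level down
+ conditional χ-bad mass (§3 records the 4′-currency reading, the background terms entering through the minimiser-stability row of crux `MinimiserStabilityRegPr`).

* §1 `ae_log_sandwich_of_descent` — ABSTRACT (any measurable spaces): transport in set form `∫_{f⁻¹s} ρ = ∫_s T` for both runs, the a.e. sandwich on `G`,
  the bad-mass bounds `∫_{f⁻¹s ∩ Gᶜ} ρ ≤ δ·∫_s T`, `δ < 1` ⇒ the a.e. log comparison of `Ta`, `Tb`.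
* §2 `setIntegral_heightDensity_descend` — THE TREE'S TRANSPORT IDENTITY one step down: `∫_{D_{n,n+1}⁻¹ s} ρ^{S}_{(n+1)} dU^{(n+1)} = ∫_s ρ^{S}_{(n)} dU^{(n)}` for the
  restricted height densities of ONE run read at the heights `n+1` and `n` (any measurable event `S`, `γ ≥ 0`); `ae_log_sandwich_heightDensity` — §1 instantiated.
* §3 `fourPrimeBody_of_descent` — the 4′-currency reading for one cut-off pair: add the minimiser-stability row at height `n` (`|bg′ − bg − κ₃| ≤ r₃` on the
  window, crux `MinimiserStabilityRegPr`'s body) to get `|(log Tb + bg′) − (log Ta + bg) − (κ + κ₃)| ≤ r − log(1−δ) + r₃` a.e. on the window.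

WHAT THIS IS NOT: not a proof of 4′; the level-`(n+1)` sandwich on `G` and the conditional bad mass are HYPOTHESES (the first = the large-`L` rows read one
level down on χ-good data; the second = card C6's `ConditionalEdgeMass`, located-unprinted, whose deterministic core is a clamped-cascade margin).

References: T. Bałaban, CMP 102 (1985) 255–275 [Balaban1985UV3] ((2) p.256, (41) p.266, (47) p.267); CMP 109 (1987) 249–301 [Balaban1987RG1] ((0.11) p.253);
C. King, CMP 102 (1986) 649–677 [King1986] (Thm 3.4 (3.9) p.656).
-/

noncomputable section

namespace Summit.QuantumFields.YangMills.Theorems.PrintChiDescent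

open MeasureTheory Filter Set
open Literature.MathematicalPhysics.QuantumFieldTheory.Balaban1983to89
open Literature.MathematicalPhysics.QuantumFieldTheory.Balaban1983to89.T3ContinuumYM3Torus
open Literature.MathematicalPhysics.QuantumFieldTheory.Balaban1983to89.T3UnitLawDensityEML (ℰp measurableE_ℰp)
open Literature.MathematicalPhysics.QuantumFieldTheory.Balaban1983to89.T3UnitScaleTilt
open Literature.MathematicalPhysics.QuantumFieldTheory.Balaban1983to89.T3TiltDescent
open Literature.MathematicalPhysics.QuantumFieldTheory.Balaban1983to89.T3DescentFibreTower
open Literature.MathematicalPhysics.QuantumFieldTheory.Balaban1983to89.T3PrintedRegularMinimiser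
open Literature.MathematicalPhysics.QuantumFieldTheory.Balaban1983to89.Missing

/-! ## §1 The abstract descent sandwich (set-integral form) -/

section Abstract

variable {X Y : Type*} [MeasurableSpace X] [MeasurableSpace Y] {μ : Measure X} {ν : Measure Y} {f : X → Y}

/-- Splitting a set integral along a measurable set: `∫_{A} ρ = ∫_{A ∩ G} ρ + ∫_{A ∩ Gᶜ} ρ` (local helper). [folklore] -/
private theorem setIntegral_split {ρ : X → ℝ} (hρ : Integrable ρ μ) (A : Set X) {G : Set X} (hG : MeasurableSet G) :
    ∫ x in A, ρ x ∂μ = (∫ x in A ∩ G, ρ x ∂μ) + ∫ x in A ∩ Gᶜ, ρ x ∂μ := by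
  rw [← Set.sdiff_eq, integral_inter_add_sdiff hG hρ.integrableOn]

/-- **THE DESCENT SANDWICH, ABSTRACTLY** (card C6's `descentSandwich`, set-integral form).  Data: a measurable map `f : X → Y`, nonnegative integrable
densities `ρa, ρb` on `X` whose push-forwards along `f` have the nonnegative integrable densities `Ta, Tb` on `Y` (transport in set form: `∫_{f⁻¹s} ρ = ∫_s T` for
every measurable `s`), a measurable good set `G ⊆ X`.  If `e^{κ−r}ρa ≤ ρb ≤ e^{κ+r}ρa` a.e. on `G`, and the bad parts transport to at most the fraction `δ < 1`
of the totals (`∫_{f⁻¹s ∩ Gᶜ} ρ ≤ δ·∫_s T` for both runs and every measurable `s`), then a.e. on `Y` where both `Ta, Tb` are positive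
`|log Tb − log Ta − κ| ≤ r − log(1 − δ)`.  (Test against sets; `ae_nonneg_of_forall_setIntegral_nonneg`.) [cite: King1986, Thm 3.4 (3.9) p.656] -/
theorem ae_log_sandwich_of_descent [IsFiniteMeasure ν] (hf : Measurable f)
    {ρa ρb : X → ℝ} {Ta Tb : Y → ℝ} (hρa : Integrable ρa μ) (hρb : Integrable ρb μ) (hTa : Integrable Ta ν) (hTb : Integrable Tb ν)
    (hρa0 : ∀ x, 0 ≤ ρa x) (hρb0 : ∀ x, 0 ≤ ρb x)
    (hTa_tr : ∀ s, MeasurableSet s → ∫ x in f ⁻¹' s, ρa x ∂μ = ∫ y in s, Ta y ∂ν)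
    (hTb_tr : ∀ s, MeasurableSet s → ∫ x in f ⁻¹' s, ρb x ∂μ = ∫ y in s, Tb y ∂ν)
    {G : Set X} (hG : MeasurableSet G) {κ r δ : ℝ} (hδ : δ < 1)
    (hcmp : ∀ᵐ x ∂μ, x ∈ G → Real.exp (κ - r) * ρa x ≤ ρb x ∧ ρb x ≤ Real.exp (κ + r) * ρa x)
    (hbadA : ∀ s, MeasurableSet s → ∫ x in f ⁻¹' s ∩ Gᶜ, ρa x ∂μ ≤ δ * ∫ y in s, Ta y ∂ν)
    (hbadB : ∀ s, MeasurableSet s → ∫ x in f ⁻¹' s ∩ Gᶜ, ρb x ∂μ ≤ δ * ∫ y in s, Tb y ∂ν) :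
    ∀ᵐ y ∂ν, 0 < Ta y → 0 < Tb y → |Real.log (Tb y) - Real.log (Ta y) - κ| ≤ r - Real.log (1 - δ) := by
  have h1δ : 0 < 1 - δ := by linarith
  -- set-wise consequences of the a.e. sandwich on `G`
  have hGlo : ∀ s, MeasurableSet s →
      Real.exp (κ - r) * ∫ x in f ⁻¹' s ∩ G, ρa x ∂μ ≤ ∫ x in f ⁻¹' s ∩ G, ρb x ∂μ := by
    intro s hs
    rw [← integral_const_mul]
    refine setIntegral_mono_on_ae ((hρa.const_mul _).integrableOn) hρb.integrableOn ((hf hs).inter hG) ?_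
    filter_upwards [hcmp] with x hx hxs
    exact (hx hxs.2).1
  have hGhi : ∀ s, MeasurableSet s →
      ∫ x in f ⁻¹' s ∩ G, ρb x ∂μ ≤ Real.exp (κ + r) * ∫ x in f ⁻¹' s ∩ G, ρa x ∂μ := by
    intro s hs
    rw [← integral_const_mul]
    refine setIntegral_mono_on_ae hρb.integrableOn ((hρa.const_mul _).integrableOn) ((hf hs).inter hG) ?_
    filter_upwards [hcmp] with x hx hxs
    exact (hx hxs.2).2
  -- (i) lower: `e^{κ−r}(1−δ)·Ta ≤ Tb` a.e.
  have hlo : ∀ᵐ y ∂ν, Real.exp (κ - r) * (1 - δ) * Ta y ≤ Tb y := by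
    have hint : Integrable (fun y => Tb y - Real.exp (κ - r) * (1 - δ) * Ta y) ν := hTb.sub (hTa.const_mul _)
    have key := ae_nonneg_of_forall_setIntegral_nonneg hint fun s hs _ => by
      rw [integral_sub hTb.integrableOn (hTa.const_mul _).integrableOn, integral_const_mul, sub_nonneg]
      have hsplitA := setIntegral_split hρa (f ⁻¹' s) hG
      have hsplitB := setIntegral_split hρb (f ⁻¹' s) hG
      have hBnn : 0 ≤ ∫ x in f ⁻¹' s ∩ Gᶜ, ρb x ∂μ := setIntegral_nonneg ((hf hs).inter hG.compl) fun x _ => hρb0 x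
      have hA := hTa_tr s hs
      have hB := hTb_tr s hs
      have h1 := hGlo s hs
      have h2 := hbadA s hs
      have hexp : 0 < Real.exp (κ - r) := Real.exp_pos _
      -- ∫_s Tb = ∫_{f⁻¹s∩G} ρb + (≥ 0) ≥ e^{κ−r} ∫_{f⁻¹s∩G} ρa = e^{κ−r}(∫_s Ta − bad) ≥ e^{κ−r}(1−δ)∫_s Ta
      nlinarith
    filter_upwards [key] with y hy
    simpa [sub_nonneg] using hy
  -- (ii) upper: `(1−δ)·Tb ≤ e^{κ+r}·Ta` a.e.
  have hhi : ∀ᵐ y ∂ν, (1 - δ) * Tb y ≤ Real.exp (κ + r) * Ta y := by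
    have hint : Integrable (fun y => Real.exp (κ + r) * Ta y - (1 - δ) * Tb y) ν := (hTa.const_mul _).sub (hTb.const_mul _)
    have key := ae_nonneg_of_forall_setIntegral_nonneg hint fun s hs _ => by
      rw [integral_sub (hTa.const_mul _).integrableOn (hTb.const_mul _).integrableOn, integral_const_mul, integral_const_mul,
        sub_nonneg]
      have hsplitA := setIntegral_split hρa (f ⁻¹' s) hG
      have hsplitB := setIntegral_split hρb (f ⁻¹' s) hG
      have hAnn : 0 ≤ ∫ x in f ⁻¹' s ∩ Gᶜ, ρa x ∂μ := setIntegral_nonneg ((hf hs).inter hG.compl) fun x _ => hρa0 x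
      have hA := hTa_tr s hs
      have hB := hTb_tr s hs
      have h1 := hGhi s hs
      have h2 := hbadB s hs
      have hexp : 0 < Real.exp (κ + r) := Real.exp_pos _
      -- (1−δ)∫_s Tb ≤ ∫_s Tb − bad_b = ∫_{f⁻¹s∩G} ρb ≤ e^{κ+r}∫_{f⁻¹s∩G} ρa ≤ e^{κ+r} ∫_s Ta
      nlinarith
    filter_upwards [key] with y hy
    simpa [sub_nonneg] using hy
  filter_upwards [hlo, hhi] with y hylo hyhi hTa0 hTb0'
  have hexp1 : 0 < Real.exp (κ - r) := Real.exp_pos _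
  have hexp2 : 0 < Real.exp (κ + r) := Real.exp_pos _
  have hlogTa := Real.log_le_log (by positivity : 0 < Real.exp (κ - r) * (1 - δ) * Ta y) hylo
  rw [Real.log_mul (by positivity) hTa0.ne', Real.log_mul hexp1.ne' h1δ.ne', Real.log_exp] at hlogTa
  have hlogTb := Real.log_le_log (by positivity : 0 < (1 - δ) * Tb y) hyhi
  rw [Real.log_mul h1δ.ne' hTb0'.ne', Real.log_mul hexp2.ne' hTa0.ne', Real.log_exp] at hlogTb
  rw [abs_le]
  constructor <;> linarith

end Abstract

/-! ## §2 The tree's one-step transport identity and the descent sandwich for the restricted height densities -/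

section Tree

variable (F : T3Family) {γ : ℝ}

/-- **THE ONE-STEP TRANSPORT IDENTITY OF THE RESTRICTED HEIGHT DENSITIES**: for ONE run `K`, any measurable event `S` of its fine fields and heights
`n < n+1 ≤ K`, the height-`n` density is the push-forward of the height-`(n+1)` density along the one-step averaging `D_{n,n+1}`:
`∫_{D_{n,n+1}⁻¹ s} ρ^{S}_{(n+1)} dU^{(n+1)} = ∫_s ρ^{S}_{(n)} dU^{(n)}` for every measurable `s` (`γ ≥ 0`).  Tree: `D_{n,K} = D_{n,n+1} ∘ D_{n+1,K}`
(`descendTo_descendTo`) and `(D_{·,K})_*(Gibbs_K|S) = dU·Z_K⁻¹ρ^S` (`map_descendTo_restrict_eq_withDensity`) at both heights. [cite: Balaban1987RG1, (0.11) p.253] -/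
theorem setIntegral_heightDensity_descend (hγ : 0 ≤ γ) {n K : ℕ} (h : n + 1 ≤ K)
    {S : Set (GaugeField (F.P K) 0 (Matrix.specialUnitaryGroup (Fin 2) ℂ))} (hS : MeasurableSet S)
    {s : Set (GaugeField (F.P n) 0 (Matrix.specialUnitaryGroup (Fin 2) ℂ))} (hs : MeasurableSet s) :
    ∫ W in (descendTo F ℰp n (n + 1) (Nat.le_succ n)) ⁻¹' s, heightDensity F γ h S W
        ∂fieldMeasure (F.P (n + 1)) 0 (Matrix.specialUnitaryGroup (Fin 2) ℂ) =
      ∫ V in s, heightDensity F γ (Nat.le_of_succ_le h) S V ∂fieldMeasure (F.P n) 0 (Matrix.specialUnitaryGroup (Fin 2) ℂ) := by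
  set Z : ℝ := partitionFn (G := Matrix.specialUnitaryGroup (Fin 2) ℂ) (F.P K) ((F.scheme ℰp γ).β K) with hZdef
  have hZ : 0 < Z := partitionFn_pos' _ (F.scheme_β_nonneg ℰp hγ K)
  have hf : Measurable (descendTo F ℰp n (n + 1) (Nat.le_succ n) :
      GaugeField (F.P (n + 1)) 0 (Matrix.specialUnitaryGroup (Fin 2) ℂ) → GaugeField (F.P n) 0 (Matrix.specialUnitaryGroup (Fin 2) ℂ)) :=
    measurable_descendTo F ℰp measurableE_ℰp _
  have hcomp : (descendTo F ℰp n K (Nat.le_of_succ_le h) :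
      GaugeField (F.P K) 0 (Matrix.specialUnitaryGroup (Fin 2) ℂ) → GaugeField (F.P n) 0 (Matrix.specialUnitaryGroup (Fin 2) ℂ)) =
      descendTo F ℰp n (n + 1) (Nat.le_succ n) ∘ descendTo F ℰp (n + 1) K h :=
    funext fun U => (descendTo_descendTo F ℰp (Nat.le_succ n) h U).symm
  -- the two push-forward identities, and the push-forward composed
  have hA := map_descendTo_restrict_eq_withDensity F (Nat.le_of_succ_le h) hS hγ
  have hB := map_descendTo_restrict_eq_withDensity F h hS hγ
  have hmap : Measure.map (descendTo F ℰp n K (Nat.le_of_succ_le h)) ((gibbsK F ℰp γ K).restrict S) =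
      Measure.map (descendTo F ℰp n (n + 1) (Nat.le_succ n))
        (Measure.map (descendTo F ℰp (n + 1) K h) ((gibbsK F ℰp γ K).restrict S)) := by
    rw [Measure.map_map hf (measurable_descendTo F ℰp measurableE_ℰp _), ← hcomp]
  rw [hA, hB] at hmap
  -- evaluate on `s`
  have hev : ((fieldMeasure (F.P n) 0 (Matrix.specialUnitaryGroup (Fin 2) ℂ)).withDensity fun V =>
        ENNReal.ofReal (Z⁻¹ * heightDensity F γ (Nat.le_of_succ_le h) S V)) s =
      (Measure.map (descendTo F ℰp n (n + 1) (Nat.le_succ n))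
        ((fieldMeasure (F.P (n + 1)) 0 (Matrix.specialUnitaryGroup (Fin 2) ℂ)).withDensity fun W =>
          ENNReal.ofReal (Z⁻¹ * heightDensity F γ h S W))) s := by rw [hmap]
  rw [withDensity_apply _ hs, Measure.map_apply hf hs, withDensity_apply _ (hf hs)] at hev
  -- both sides as real integrals of nonnegative functions
  obtain ⟨hTm, hTi⟩ := heightDensity_props F (Nat.le_of_succ_le h) hS hγ
  obtain ⟨hρm, hρi⟩ := heightDensity_props F h hS hγ
  have hT0 := heightDensity_nonneg F γ (Nat.le_of_succ_le h) S
  have hρ0 := heightDensity_nonneg F γ h S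
  have e1 : ∫ V in s, Z⁻¹ * heightDensity F γ (Nat.le_of_succ_le h) S V ∂fieldMeasure (F.P n) 0 (Matrix.specialUnitaryGroup (Fin 2) ℂ) =
      (∫⁻ V in s, ENNReal.ofReal (Z⁻¹ * heightDensity F γ (Nat.le_of_succ_le h) S V)
        ∂fieldMeasure (F.P n) 0 (Matrix.specialUnitaryGroup (Fin 2) ℂ)).toReal :=
    integral_eq_lintegral_of_nonneg_ae (Eventually.of_forall fun V => mul_nonneg (inv_nonneg.mpr hZ.le) (hT0 V))
      (hTm.const_mul _).aestronglyMeasurable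
  have e2 : ∫ W in (descendTo F ℰp n (n + 1) (Nat.le_succ n)) ⁻¹' s, Z⁻¹ * heightDensity F γ h S W
        ∂fieldMeasure (F.P (n + 1)) 0 (Matrix.specialUnitaryGroup (Fin 2) ℂ) =
      (∫⁻ W in (descendTo F ℰp n (n + 1) (Nat.le_succ n)) ⁻¹' s, ENNReal.ofReal (Z⁻¹ * heightDensity F γ h S W)
        ∂fieldMeasure (F.P (n + 1)) 0 (Matrix.specialUnitaryGroup (Fin 2) ℂ)).toReal :=
    integral_eq_lintegral_of_nonneg_ae (Eventually.of_forall fun W => mul_nonneg (inv_nonneg.mpr hZ.le) (hρ0 W))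
      (hρm.const_mul _).aestronglyMeasurable
  have e3 : ∫ W in (descendTo F ℰp n (n + 1) (Nat.le_succ n)) ⁻¹' s, Z⁻¹ * heightDensity F γ h S W
        ∂fieldMeasure (F.P (n + 1)) 0 (Matrix.specialUnitaryGroup (Fin 2) ℂ) =
      ∫ V in s, Z⁻¹ * heightDensity F γ (Nat.le_of_succ_le h) S V ∂fieldMeasure (F.P n) 0 (Matrix.specialUnitaryGroup (Fin 2) ℂ) := by
    rw [e1, e2, hev]
  rw [integral_const_mul, integral_const_mul] at e3
  exact mul_left_cancel₀ (inv_ne_zero hZ.ne') e3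

/-- **THE DESCENT SANDWICH FOR THE RESTRICTED HEIGHT DENSITIES OF TWO CONSECUTIVE RUNS** (§1 on the tree's objects).  Runs `K`, `K+1` with measurable
events `S`, `S′` of their fine fields; heights `n < n+1 ≤ K`; `ρa = ρ^{(K),S}_{(n+1)}`, `ρb = ρ^{(K+1),S′}_{(n+1)}` (level `n+1`), `Ta = ρ^{(K),S}_{(n)}`,
`Tb = ρ^{(K+1),S′}_{(n)}` (level `n`), `f = D_{n,n+1}` the COMMON one-step averaging.  If `e^{κ−r}ρa ≤ ρb ≤ e^{κ+r}ρa` a.e. on a measurable good set `G` of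
level-`(n+1)` fields and both runs give the fibres' bad parts relative mass `≤ δ < 1` (`∫_{f⁻¹s ∩ Gᶜ} ρ ≤ δ∫_s T`), then a.e. where `Ta, Tb > 0`:
`|log Tb − log Ta − κ| ≤ r − log(1−δ)` — at EVERY datum of the height-`n` lattice, edge band included. [cite: King1986, Thm 3.4 (3.9) p.656] -/
theorem ae_log_sandwich_heightDensity (hγ : 0 ≤ γ) {n K : ℕ} (h : n + 1 ≤ K)
    {S : Set (GaugeField (F.P K) 0 (Matrix.specialUnitaryGroup (Fin 2) ℂ))} (hS : MeasurableSet S)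
    {S' : Set (GaugeField (F.P (K + 1)) 0 (Matrix.specialUnitaryGroup (Fin 2) ℂ))} (hS' : MeasurableSet S')
    {G : Set (GaugeField (F.P (n + 1)) 0 (Matrix.specialUnitaryGroup (Fin 2) ℂ))} (hG : MeasurableSet G) {κ r δ : ℝ} (hδ : δ < 1)
    (hcmp : ∀ᵐ W ∂fieldMeasure (F.P (n + 1)) 0 (Matrix.specialUnitaryGroup (Fin 2) ℂ), W ∈ G →
      Real.exp (κ - r) * heightDensity F γ h S W ≤ heightDensity F γ (h.trans (Nat.le_succ K)) S' W ∧
      heightDensity F γ (h.trans (Nat.le_succ K)) S' W ≤ Real.exp (κ + r) * heightDensity F γ h S W)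
    (hbadA : ∀ s, MeasurableSet s →
      ∫ W in (descendTo F ℰp n (n + 1) (Nat.le_succ n)) ⁻¹' s ∩ Gᶜ, heightDensity F γ h S W
          ∂fieldMeasure (F.P (n + 1)) 0 (Matrix.specialUnitaryGroup (Fin 2) ℂ) ≤
        δ * ∫ V in s, heightDensity F γ (Nat.le_of_succ_le h) S V ∂fieldMeasure (F.P n) 0 (Matrix.specialUnitaryGroup (Fin 2) ℂ))
    (hbadB : ∀ s, MeasurableSet s →
      ∫ W in (descendTo F ℰp n (n + 1) (Nat.le_succ n)) ⁻¹' s ∩ Gᶜ, heightDensity F γ (h.trans (Nat.le_succ K)) S' W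
          ∂fieldMeasure (F.P (n + 1)) 0 (Matrix.specialUnitaryGroup (Fin 2) ℂ) ≤
        δ * ∫ V in s, heightDensity F γ ((Nat.le_of_succ_le h).trans (Nat.le_succ K)) S' V
          ∂fieldMeasure (F.P n) 0 (Matrix.specialUnitaryGroup (Fin 2) ℂ)) :
    ∀ᵐ V ∂fieldMeasure (F.P n) 0 (Matrix.specialUnitaryGroup (Fin 2) ℂ),
      0 < heightDensity F γ (Nat.le_of_succ_le h) S V → 0 < heightDensity F γ ((Nat.le_of_succ_le h).trans (Nat.le_succ K)) S' V →
        |Real.log (heightDensity F γ ((Nat.le_of_succ_le h).trans (Nat.le_succ K)) S' V) -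
            Real.log (heightDensity F γ (Nat.le_of_succ_le h) S V) - κ| ≤ r - Real.log (1 - δ) := by
  obtain ⟨_, hTi⟩ := heightDensity_props F (Nat.le_of_succ_le h) hS hγ
  obtain ⟨_, hρi⟩ := heightDensity_props F h hS hγ
  obtain ⟨_, hTi'⟩ := heightDensity_props F ((Nat.le_of_succ_le h).trans (Nat.le_succ K)) hS' hγ
  obtain ⟨_, hρi'⟩ := heightDensity_props F (h.trans (Nat.le_succ K)) hS' hγ
  exact ae_log_sandwich_of_descent (measurable_descendTo F ℰp measurableE_ℰp _) hρi hρi' hTi hTi'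
    (heightDensity_nonneg F γ h S) (heightDensity_nonneg F γ _ S')
    (fun s hs => setIntegral_heightDensity_descend F hγ h hS hs)
    (fun s hs => setIntegral_heightDensity_descend F hγ (h.trans (Nat.le_succ K)) hS' hs)
    hG hδ hcmp hbadA hbadB

end Tree

/-! ## §3 The 4′-currency reading for one cut-off pair -/

section FourPrime

variable (F : T3Family) {γ : ℝ}

/-- **ONE CUT-OFF PAIR OF 4′ BY DESCENT.**  At the route's comparison height `n = ⌊K/m⌋` (with `n + 1 ≤ K`), for the `histGood`-restricted height densities of
runs `K` and `K+1`: the level-`(n+1)` two-run sandwich on a good set `G` with constant `κ` and radius `r`, the conditional bad mass `δ < 1` of both runs, and the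
minimiser-stability row at height `n` (`|bg′_K − bg_K − κ₃| ≤ r₃` on the window — the body of crux `MinimiserStabilityRegPr` for this `K`) give the 4′
inequality at EVERY window datum where both densities are positive: `|(log ρ_{K+1} + bg′_K) − (log ρ_K + bg_K) − (κ + κ₃)| ≤ (r − log(1−δ)) + r₃`.  No
representation at height `n` is used — the edge band of FINDING #44 is covered by the same hypotheses as the interior. [cite: King1986, Thm 3.4 (3.9) p.656] -/
theorem fourPrime_pair_of_descent (hγ : 0 ≤ γ) (b₀ p₀ ε₀ : ℝ) {m K : ℕ} (h : K / m + 1 ≤ K)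
    {G : Set (GaugeField (F.P (K / m + 1)) 0 (Matrix.specialUnitaryGroup (Fin 2) ℂ))} (hG : MeasurableSet G) {κ r δ κ₃ r₃ : ℝ} (hδ : δ < 1)
    (hcmp : ∀ᵐ W ∂fieldMeasure (F.P (K / m + 1)) 0 (Matrix.specialUnitaryGroup (Fin 2) ℂ), W ∈ G →
      Real.exp (κ - r) * heightDensity F γ h (histGood F ℰp (θBal F.L γ b₀ p₀) K (K / m)) W ≤
          heightDensity F γ (h.trans (Nat.le_succ K)) (histGood F ℰp (θBal F.L γ b₀ p₀) (K + 1) (K / m)) W ∧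
        heightDensity F γ (h.trans (Nat.le_succ K)) (histGood F ℰp (θBal F.L γ b₀ p₀) (K + 1) (K / m)) W ≤
          Real.exp (κ + r) * heightDensity F γ h (histGood F ℰp (θBal F.L γ b₀ p₀) K (K / m)) W)
    (hbadA : ∀ s, MeasurableSet s →
      ∫ W in (descendTo F ℰp (K / m) (K / m + 1) (Nat.le_succ _)) ⁻¹' s ∩ Gᶜ,
          heightDensity F γ h (histGood F ℰp (θBal F.L γ b₀ p₀) K (K / m)) W ∂fieldMeasure (F.P (K / m + 1)) 0 (Matrix.specialUnitaryGroup (Fin 2) ℂ) ≤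
        δ * ∫ V in s, heightDensity F γ (Nat.div_le_self K m) (histGood F ℰp (θBal F.L γ b₀ p₀) K (K / m)) V
          ∂fieldMeasure (F.P (K / m)) 0 (Matrix.specialUnitaryGroup (Fin 2) ℂ))
    (hbadB : ∀ s, MeasurableSet s →
      ∫ W in (descendTo F ℰp (K / m) (K / m + 1) (Nat.le_succ _)) ⁻¹' s ∩ Gᶜ,
          heightDensity F γ (h.trans (Nat.le_succ K)) (histGood F ℰp (θBal F.L γ b₀ p₀) (K + 1) (K / m)) W
          ∂fieldMeasure (F.P (K / m + 1)) 0 (Matrix.specialUnitaryGroup (Fin 2) ℂ) ≤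
        δ * ∫ V in s, heightDensity F γ ((Nat.div_le_self K m).trans (Nat.le_succ K)) (histGood F ℰp (θBal F.L γ b₀ p₀) (K + 1) (K / m)) V
          ∂fieldMeasure (F.P (K / m)) 0 (Matrix.specialUnitaryGroup (Fin 2) ℂ))
    (hmin : ∀ V : GaugeField (F.P (K / m)) 0 (Matrix.specialUnitaryGroup (Fin 2) ℂ), PlaqSmall (θBal F.L γ b₀ p₀ (K / m)) V →
      |bgRegPr' F γ m ε₀ K V - bgRegPr F γ m ε₀ K V - κ₃| ≤ r₃) :
    ∀ᵐ V ∂fieldMeasure (F.P (K / m)) 0 (Matrix.specialUnitaryGroup (Fin 2) ℂ),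
      PlaqSmall (θBal F.L γ b₀ p₀ (K / m)) V →
        0 < heightDensity F γ (Nat.div_le_self K m) (histGood F ℰp (θBal F.L γ b₀ p₀) K (K / m)) V →
        0 < heightDensity F γ ((Nat.div_le_self K m).trans (Nat.le_succ K)) (histGood F ℰp (θBal F.L γ b₀ p₀) (K + 1) (K / m)) V →
          |(Real.log (heightDensity F γ ((Nat.div_le_self K m).trans (Nat.le_succ K))
                (histGood F ℰp (θBal F.L γ b₀ p₀) (K + 1) (K / m)) V) + bgRegPr' F γ m ε₀ K V) -
            (Real.log (heightDensity F γ (Nat.div_le_self K m) (histGood F ℰp (θBal F.L γ b₀ p₀) K (K / m)) V) + bgRegPr F γ m ε₀ K V) -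
              (κ + κ₃)| ≤ (r - Real.log (1 - δ)) + r₃ := by
  have hsand := ae_log_sandwich_heightDensity F hγ h (measurableSet_histGood F ℰp measurableE_ℰp _ K _)
    (measurableSet_histGood F ℰp measurableE_ℰp _ (K + 1) _) hG hδ hcmp hbadA hbadB
  filter_upwards [hsand] with V hV hs h0 h0'
  have h1 := hV h0 h0'
  have h2 := hmin V hs
  have key : ∀ x y b b' : ℝ, (x + b') - (y + b) - (κ + κ₃) = (x - y - κ) + (b' - b - κ₃) := by intros; ring
  rw [key]
  exact (abs_add_le _ _).trans (add_le_add h1 h2)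

end FourPrime



end Summit.QuantumFields.YangMills.Theorems.PrintChiDescent

end
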